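/-
Copyright (c) 2026 the pub-hodgecm-mathlib formalisation cell (harness21).  Prover seat hodgecm-mathlib-K2E4-p10 (g10), Track B «K2-LIT»,
#184♮ = hLiu418 = `stmt-HodgeConjecture-24832`; socket #41, KIND 1 — (K1a-dec-den₂) ★ p864440's `hdec_of_factorBounds_den` WITH (L2) IN THE COMMON-DENOMINATOR CURRENCY TOO
(K2Liu-p03 (g8) 2026-09-05T02:11:05Z «≠ on one slot»; K1a desk K2Liu-p01 (g11) WORD #3 (2); sibling file — an ED. 2 of ★ p864440 would pass 400 lines).  THEOREMS ONLY (no `def`,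
no `instance`, no notation, no named-fact hypothesis, no `sorry`).
-/
import Summits.HodgeConjecture.HodgeConjecture.Theorems.K2LiuKindOneSingularDecayOfLettersDen   -- ★ p864440 (this seat): ED. 1 (`_den`, `hGb_of_countLetter_den`) and all its imports
import HarnessLib

/-!
# Crux `HLiu418`, socket #41, KIND 1 — (K1a-dec-den₂) `K2LiuKindOneSingularDecayOfLettersDenTwo`: the (dec) letter of ★ p863404 §2 from per-factor bounds, ALL FOUR analytic letters
# in the common-denominator currency (the archimedean one included), the denominator killed by (supp½) and the identity theorem

Cell `hodgecm-mathlib`, crux item hLiu418 = `stmt-HodgeConjecture-24832` (helper lane `--supports … --as helper`, count-neutral), route of record `HCCMUnconditional`;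
squad K2 ∕ K2Liu, road `K2_Liu`, socket #41, KIND 1 a♮; K1a desk K2Liu-p01 (g11) (consumer: (α) ED. 4 `exists_kindOne_singularTerm_of_record₄`), deputy this seat.
WHY ED. 2 (K2Liu-p03 (g8), (L2-dock) census 2026-09-05T02:10:23Z ∕ 02:11:05Z): the continued archimedean letter at the corner frame is
`(π∕p)·e^{−πpt}·(p∕4 det V)^{2s}·Γ(2s)·Φ_t(…)×|det denom|^{…}` with `p·t ≍ ⟨V(h_w), ι_w S⟩`; its GAUSSIAN docks `S`-uniformly through the JOINT parameter
(`Q ≥ c·λ_min(V(h_∞))·‖ι_∞ S‖`, `λ_min ≥ c′·H(h)^{−2}`) onto `e^{−b·H^{−a′}·τa S}` at `τa := ‖ι_∞ S‖`, but its polynomial PREFACTOR (negative powers of `p·t` from ★ p863763's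
`Φ`-bounds) has an `S`-uniform floor only through `∏_w ‖ι_w S‖ ≥ |N(S_ab)| ≥ d^{−[L:ℚ]}` for a common denominator `d` — so (L2) is `d`-CURRENCY TOO:
`‖Ac S i s h‖ ≤ C·H^a·(e^{−b·H^{−a′}·τa S}·(1 + τa S)^{N₁})·d^{N_{d,1}}`.  **`hdec_of_factorBounds_den₂`** = ★ p864440 §2 with that one binder changed (bytes = K2Liu-p03's
02:11:05Z line); proof identical with `Md := Nd₁ + Nd₂ + Nd₃ + Nd₄` (on the support `d ≤ Ca·H^{κa}`, `d^{Md} ≤ Ca^{Md}·H^{κa·Md}`; off it `X ≡ 0` by ★ `eqOn_of_eqOn_halfPlane`).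
SAME CONCLUSION BYTES as ★ p863488 ∕ ★ p864440 (`∃ Na, … hdec`).
[MoeglinWaldspurger1995, II.1.7, IV.1.9], [Shimura1982, §4 Thm. 4.2], [Shimura1997, §18.4 Prop. 18.14], [BorelJacquet1979, §1.2], [Tan1999, §3, §4 Prop. 4.8], [Conway1978, IV.3].
HONEST LABEL.  Elementary-estimate bookkeeping, count-neutral, hypothesis-first on the factor letters, the support letter and `hXhol`; it closes no socket: `HC_CM` is proved only
modulo the 7 printed citations (2 remaining named inputs: hLiu418 = `stmt-HodgeConjecture-24832`, h413 = `stmt-HodgeConjecture-24833`) until rung 0 closes.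
-/

set_option autoImplicit false
-- the mandated namespace repeats the single-problem summit's segment (`HodgeConjecture.HodgeConjecture`)
set_option linter.dupNamespace false

noncomputable section

open scoped Matrix ENNReal NNReal Topology ComplexConjugate
open NumberField IsDedekindDomain MeasureTheory MeasureTheory.Measure Filter Set Function Metric
open Literature.NumberTheory.Automorphic Literature.NumberTheory.Automorphic.UnitaryGroup Literature.NumberTheory.GaloisRepresentations
open Literature.NumberTheory.LFunctions
open Literature.NumberTheory.GelbartRogawski1991 Literature.NumberTheory.GelbartRogawski1991.GRConstruction
open Literature.NumberTheory.K2Lit.SiegelDoubled Literature.MeasureTheory.Group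
open Literature.NumberTheory.Automorphic.IdeleClassGroup

namespace Summit.HodgeConjecture.HodgeConjecture.Cruxes.HLiu418.K2LiuKindOneSingularDecayOfLettersDenTwo

open K2LiuSiegelUnipotentFourierDefs K2LiuSiegelUnipotentCharacters K2LiuUnipotentCoveringWeight K2LiuSiegelFourierCoeffDelta
open K2LiuSiegelEisensteinKindWLocalExponents (one_add_pow_mul_exp_neg_le)
open K2LiuIwasawaHeightLatticeSumBound (exists_adelicHeightGL_floor)
open K2LiuKindOneSingularScalarChangeOfSet (norm_transportedG_le)
open K2LiuKindOneSingularScalarBound (re_pos_of_dist_le_half)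
open K2LiuEisensteinContinuationGlue (eqOn_of_eqOn_halfPlane)

open Classical in
/-- **(K1a-dec-den₂) THE SAME WITH (L2) IN THE COMMON-DENOMINATOR CURRENCY TOO** (ED. 2; K2Liu-p03 (g8) 2026-09-05T02:11:05Z «≠ on one slot», K1a desk WORD #3 (2)): the
archimedean letter's polynomial PREFACTOR sees the denominator as well — `|cA|·∏_w ‖Acw‖` has an `S`-uniform floor only through `∏_w ‖ι_w S‖ ≥ d^{−[L:ℚ]}` — while its Gaussian
stays `e^{−b·H^{−a′}·τa S}` (JOINT parameter `Q ≥ c·λ_min·‖ι S‖`); so (L2-den) reads `‖Ac S i s h‖ ≤ C·H^a·(e^{−bH^{−a′}τa S}(1+τa S)^{N₁})·d^{N_{d,1}}` and the absorption is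
identical (`Md := Nd₁ + Nd₂ + Nd₃ + Nd₄`).  Below, the ED. 1 docstring verbatim.
**(K1a-dec-den) THE (dec) LETTER OF ★ p863404 §2 FROM PER-FACTOR BOUNDS IN THE COMMON-DENOMINATOR CURRENCY.**  ★ p863488 `hdec_of_factorBounds` with (L3)(L4)(L5) replaced by
their `d`-currency versions `∀ d ≥ 1, d·S integral → ‖factor‖ ≤ C·H^a·(1 + τa S)^N·d^{N_d}` ((L0)(L1)(L2) unchanged), plus the support letter `hsupp` in ★ p864052's OUTPUT shape
(`X S s₀ h ≠ 0`, `n∕2 < re s₀` ⇒ a denominator `d ≤ Ca·H(h)^{κa}`) and the holomorphy `hXhol` of the explicit expression on `{0 < re}` at rank-one `S`.  SAME CONCLUSION BYTES.  Per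
`(S, s, h)`: either some `X S s₀ h ≠ 0` with `n∕2 < re s₀` — then ★ p863488's estimate at the denominator `d` of `hsupp`, `d^{N_d} ≤ Ca^{N_d}·H^{κa N_d}` — or `X(·,S,h) ≡ 0` on
`{n∕2 < re}`, hence on `{0 < re}` (★ `eqOn_of_eqOn_halfPlane`), and `‖X S s h‖ = 0`.
[cite: MoeglinWaldspurger1995, II.1.7, IV.1.9] [cite: Shimura1997, §18.4 Prop. 18.14] [cite: BorelJacquet1979, §1.2] [cite: Conway1978, IV.3] -/
theorem hdec_of_factorBounds_den₂
    (L : Type) [Field L] [NumberField L] [IsCMField L] {n : ℕ} (e : Fin 2 × Fin 1 ≃ Fin n)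
    (dV : Fin 2 → L) (hdV : ∀ i, IsCMField.complexConj L (dV i) = dV i)
    (dW : Fin 1 → L) (hdW : ∀ i, IsCMField.complexConj L (dW i) = dW i)
    -- the data of the explicit expression (★ p863404 §2 (i)–(ii))
    (G : ℂ → ℂ) {ι ι' κ : Type*}
    (c : skewMatrices ((IsCMField.complexConj L : L ≃ₐ[Fp L] L) : L →+* L) ((gramR L e dV hdV dW hdW).map (algebraMap (Fp L) L)) → HA L e dV hdV dW hdW → ℂ)
    (D : skewMatrices ((IsCMField.complexConj L : L ≃ₐ[Fp L] L) : L →+* L) ((gramR L e dV hdV dW hdW).map (algebraMap (Fp L) L)) → HA L e dV hdV dW hdW → Finset κ)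
    (P : skewMatrices ((IsCMField.complexConj L : L ≃ₐ[Fp L] L) : L →+* L) ((gramR L e dV hdV dW hdW).map (algebraMap (Fp L) L)) → HA L e dV hdV dW hdW → κ → ℂ → ℂ)
    (Pm : skewMatrices ((IsCMField.complexConj L : L ≃ₐ[Fp L] L) : L →+* L) ((gramR L e dV hdV dW hdW).map (algebraMap (Fp L) L)) → HA L e dV hdV dW hdW → Finset (HeightOneSpectrum (𝓞 ↥(maximalRealSubfield L))))
    (I : skewMatrices ((IsCMField.complexConj L : L ≃ₐ[Fp L] L) : L →+* L) ((gramR L e dV hdV dW hdW).map (algebraMap (Fp L) L)) → HA L e dV hdV dW hdW → Finset ι')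
    (T : skewMatrices ((IsCMField.complexConj L : L ≃ₐ[Fp L] L) : L →+* L) ((gramR L e dV hdV dW hdW).map (algebraMap (Fp L) L)) → HA L e dV hdV dW hdW → Finset ι)
    (Ac : skewMatrices ((IsCMField.complexConj L : L ≃ₐ[Fp L] L) : L →+* L) ((gramR L e dV hdV dW hdW).map (algebraMap (Fp L) L)) → ι' → ℂ → HA L e dV hdV dW hdW → ℂ)
    (Gn : skewMatrices ((IsCMField.complexConj L : L ≃ₐ[Fp L] L) : L →+* L) ((gramR L e dV hdV dW hdW).map (algebraMap (Fp L) L)) → ι' → ι → ℂ → HA L e dV hdV dW hdW → ℂ)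
    -- the size
    (τa : skewMatrices ((IsCMField.complexConj L : L ≃ₐ[Fp L] L) : L →+* L) ((gramR L e dV hdV dW hdW).map (algebraMap (Fp L) L)) → ℝ)
    (hτa : ∀ S : skewMatrices ((IsCMField.complexConj L : L ≃ₐ[Fp L] L) : L →+* L) ((gramR L e dV hdV dW hdW).map (algebraMap (Fp L) L)),
      ‖(fun i j => NumberField.mixedEmbedding L ((S : Matrix (Fin n) (Fin n) L) i j))‖ ≤ τa S)
    -- (L0) the constant, GLOBAL
    {Cc ac : ℝ} (Nc : ℕ) (hCc : 0 ≤ Cc) (hac : 0 ≤ ac)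
    (hcb : ∀ (S : skewMatrices ((IsCMField.complexConj L : L ≃ₐ[Fp L] L) : L →+* L) ((gramR L e dV hdV dW hdW).map (algebraMap (Fp L) L))) (h : HA L e dV hdV dW hdW), (S : Matrix (Fin n) (Fin n) L) ≠ 0 → (S : Matrix (Fin n) (Fin n) L).det = 0 →
      ‖c S h‖ ≤ Cc * adelicHeightGL (n + n) L (h : GL (Fin (n + n)) (AdeleRing (𝓞 L) L)) ^ ac * (1 + τa S) ^ Nc)
    -- (L1) the tensor count, GLOBAL
    (NI : ℕ) (hI : ∀ (S : skewMatrices ((IsCMField.complexConj L : L ≃ₐ[Fp L] L) : L →+* L) ((gramR L e dV hdV dW hdW).map (algebraMap (Fp L) L))) (h : HA L e dV hdV dW hdW), (I S h).card ≤ NI)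
    -- (L2-den) the ARCHIMEDEAN factor per pure tensor: Gaussian in `τa S`, polynomial exponent `N₁` local in `z`, common-denominator currency (K2Liu-p03's bytes)
    (hAcb : ∀ z : ℂ, 0 < z.re → ∃ (N₁ Nd₁ : ℕ) (C a b a' r : ℝ), 0 ≤ C ∧ 0 ≤ a ∧ 0 < b ∧ 0 ≤ a' ∧ 0 < r ∧
      ∀ (S : skewMatrices ((IsCMField.complexConj L : L ≃ₐ[Fp L] L) : L →+* L) ((gramR L e dV hdV dW hdW).map (algebraMap (Fp L) L))) (s : ℂ), dist s z < r → ∀ h : HA L e dV hdV dW hdW, (S : Matrix (Fin n) (Fin n) L) ≠ 0 → (S : Matrix (Fin n) (Fin n) L).det = 0 →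
      ∀ d : ℕ, 1 ≤ d → (∀ i j, IsIntegral ℤ ((d : L) * (S : Matrix (Fin n) (Fin n) L) i j)) → ∀ i ∈ I S h,
      ‖Ac S i s h‖ ≤ C * adelicHeightGL (n + n) L (h : GL (Fin (n + n)) (AdeleRing (𝓞 L) L)) ^ a *
        (Real.exp (-(b * adelicHeightGL (n + n) L (h : GL (Fin (n + n)) (AdeleRing (𝓞 L) L)) ^ (-a') * τa S)) * (1 + τa S) ^ N₁) * (d : ℝ) ^ Nd₁)
    -- (L3-den) the FINITE head per pure tensor, common-denominator currency
    (hGnb : ∀ z : ℂ, 0 < z.re → ∃ (N₂ Nd₂ : ℕ) (C a r : ℝ), 0 ≤ C ∧ 0 ≤ a ∧ 0 < r ∧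
      ∀ (S : skewMatrices ((IsCMField.complexConj L : L ≃ₐ[Fp L] L) : L →+* L) ((gramR L e dV hdV dW hdW).map (algebraMap (Fp L) L))) (s : ℂ), dist s z < r → ∀ h : HA L e dV hdV dW hdW, (S : Matrix (Fin n) (Fin n) L) ≠ 0 → (S : Matrix (Fin n) (Fin n) L).det = 0 →
      ∀ d : ℕ, 1 ≤ d → (∀ i j, IsIntegral ℤ ((d : L) * (S : Matrix (Fin n) (Fin n) L) i j)) → ∀ i ∈ I S h,
      ‖∏ v ∈ T S h, Gn S i v s h‖ ≤ C * adelicHeightGL (n + n) L (h : GL (Fin (n + n)) (AdeleRing (𝓞 L) L)) ^ a * (1 + τa S) ^ N₂ * (d : ℝ) ^ Nd₂)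
    -- (L4-den) the TRANSPORTED pole-cleared K1 scalar, common-denominator currency (§1 `hGb_of_countLetter_den`)
    (hGb : ∀ z : ℂ, 0 < z.re → ∃ (N₃ Nd₃ : ℕ) (C a r : ℝ), 0 ≤ C ∧ 0 ≤ a ∧ 0 < r ∧
      ∀ (S : skewMatrices ((IsCMField.complexConj L : L ≃ₐ[Fp L] L) : L →+* L) ((gramR L e dV hdV dW hdW).map (algebraMap (Fp L) L))) (s : ℂ), dist s z < r → ∀ h : HA L e dV hdV dW hdW, (S : Matrix (Fin n) (Fin n) L) ≠ 0 → (S : Matrix (Fin n) (Fin n) L).det = 0 →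
      ∀ d : ℕ, 1 ≤ d → (∀ i j, IsIntegral ℤ ((d : L) * (S : Matrix (Fin n) (Fin n) L) i j)) →
      ‖((∏ v ∈ Pm S h, ((1 - (v.residueCard : ℂ) ^ (-(2 * s))) / ((1 - (v.residueCard : ℂ) ^ (-(2 * s + 1))) * (1 - (quadraticHeckeCharCM L).valueAtUniformizer v * (v.residueCard : ℂ) ^ (-(2 * s + 2)))))) * G s)‖ ≤ C * adelicHeightGL (n + n) L (h : GL (Fin (n + n)) (AdeleRing (𝓞 L) L)) ^ a * (1 + τa S) ^ N₃ * (d : ℝ) ^ Nd₃)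
    -- (L5-den) the SHELL POLYNOMIALS, common-denominator currency
    (hPb : ∀ z : ℂ, 0 < z.re → ∃ (N₄ Nd₄ : ℕ) (C a r : ℝ), 0 ≤ C ∧ 0 ≤ a ∧ 0 < r ∧
      ∀ (S : skewMatrices ((IsCMField.complexConj L : L ≃ₐ[Fp L] L) : L →+* L) ((gramR L e dV hdV dW hdW).map (algebraMap (Fp L) L))) (s : ℂ), dist s z < r → ∀ h : HA L e dV hdV dW hdW, (S : Matrix (Fin n) (Fin n) L) ≠ 0 → (S : Matrix (Fin n) (Fin n) L).det = 0 →
      ∀ d : ℕ, 1 ≤ d → (∀ i j, IsIntegral ℤ ((d : L) * (S : Matrix (Fin n) (Fin n) L) i j)) →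
      ‖∏ v ∈ D S h, P S h v s‖ ≤ C * adelicHeightGL (n + n) L (h : GL (Fin (n + n)) (AdeleRing (𝓞 L) L)) ^ a * (1 + τa S) ^ N₄ * (d : ℝ) ^ Nd₄)
    -- (supp½) the SUPPORT LETTER in ★ p864052's OUTPUT shape: a non-vanishing value on `{n∕2 < re}` bounds a common denominator of `S` by the height
    {Ca κa : ℝ} (hCa : 0 < Ca) (hκa : 0 ≤ κa)
    (hsupp : ∀ (S : skewMatrices ((IsCMField.complexConj L : L ≃ₐ[Fp L] L) : L →+* L) ((gramR L e dV hdV dW hdW).map (algebraMap (Fp L) L))) (s : ℂ) (h : HA L e dV hdV dW hdW),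
      (n : ℝ) / 2 < s.re → (S : Matrix (Fin n) (Fin n) L) ≠ 0 → (S : Matrix (Fin n) (Fin n) L).det = 0 →
      c S h * (∑ i ∈ I S h, Ac S i s h * ∏ v ∈ T S h, Gn S i v s h) * ((∏ v ∈ Pm S h, ((1 - (v.residueCard : ℂ) ^ (-(2 * s))) / ((1 - (v.residueCard : ℂ) ^ (-(2 * s + 1))) * (1 - (quadraticHeckeCharCM L).valueAtUniformizer v * (v.residueCard : ℂ) ^ (-(2 * s + 2)))))) * G s) * ∏ v ∈ D S h, P S h v s ≠ 0 →
      ∃ D : ℕ, 1 ≤ D ∧ (D : ℝ) ≤ Ca * adelicHeightGL (n + n) L (h : GL (Fin (n + n)) (AdeleRing (𝓞 L) L)) ^ κa ∧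
        ∀ i j, IsIntegral ℤ ((D : L) * (S : Matrix (Fin n) (Fin n) L) i j))
    -- the explicit expression is HOLOMORPHIC on `{0 < re}` at rank-one `S` (★ p863404's `hEad` road)
    (hXhol : ∀ (S : skewMatrices ((IsCMField.complexConj L : L ≃ₐ[Fp L] L) : L →+* L) ((gramR L e dV hdV dW hdW).map (algebraMap (Fp L) L))) (h : HA L e dV hdV dW hdW), (S : Matrix (Fin n) (Fin n) L) ≠ 0 → (S : Matrix (Fin n) (Fin n) L).det = 0 →
      DifferentiableOn ℂ (fun s : ℂ => c S h * (∑ i ∈ I S h, Ac S i s h * ∏ v ∈ T S h, Gn S i v s h) * ((∏ v ∈ Pm S h, ((1 - (v.residueCard : ℂ) ^ (-(2 * s))) / ((1 - (v.residueCard : ℂ) ^ (-(2 * s + 1))) * (1 - (quadraticHeckeCharCM L).valueAtUniformizer v * (v.residueCard : ℂ) ^ (-(2 * s + 2)))))) * G s) * ∏ v ∈ D S h, P S h v s) {s : ℂ | 0 < s.re}) :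
    ∃ Na : ℕ, ∀ z : ℂ, 0 < z.re → ∃ C a b a' r : ℝ, 0 ≤ C ∧ 0 ≤ a ∧ 0 < b ∧ 0 ≤ a' ∧ 0 < r ∧
      ∀ (S : skewMatrices ((IsCMField.complexConj L : L ≃ₐ[Fp L] L) : L →+* L) ((gramR L e dV hdV dW hdW).map (algebraMap (Fp L) L))) (s : ℂ), dist s z < r →
      ∀ h : HA L e dV hdV dW hdW, (S : Matrix (Fin n) (Fin n) L) ≠ 0 → (S : Matrix (Fin n) (Fin n) L).det = 0 →
      ‖c S h * (∑ i ∈ I S h, Ac S i s h * ∏ v ∈ T S h, Gn S i v s h) * ((∏ v ∈ Pm S h, ((1 - (v.residueCard : ℂ) ^ (-(2 * s))) / ((1 - (v.residueCard : ℂ) ^ (-(2 * s + 1))) * (1 - (quadraticHeckeCharCM L).valueAtUniformizer v * (v.residueCard : ℂ) ^ (-(2 * s + 2)))))) * G s) * ∏ v ∈ D S h, P S h v s‖ ≤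
        C * adelicHeightGL (n + n) L (h : GL (Fin (n + n)) (AdeleRing (𝓞 L) L)) ^ a *
          (Real.exp (-(b * adelicHeightGL (n + n) L (h : GL (Fin (n + n)) (AdeleRing (𝓞 L) L)) ^ (-a') * τa S)) * (1 + τa S) ^ Na) := by
  -- `n = 2`: the height lives on `GL_{n+n}(𝔸_L)` with `n + n ≠ 0` (positivity ∕ floor of the adelic height)
  have hn : n = 2 := by simpa using (Fintype.card_congr e).symm
  haveI : NeZero (n + n) := ⟨by omega⟩
  obtain ⟨c₀, hc₀, hfloor⟩ := exists_adelicHeightGL_floor L (n + n)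
  refine ⟨0, fun z hz => ?_⟩
  obtain ⟨N₁, Nd₁, C₁, a₁, b, a', r₁, hC₁, ha₁, hb, ha', hr₁, hB₁⟩ := hAcb z hz
  obtain ⟨N₂, Nd₂, C₂, a₂, r₂, hC₂, ha₂, hr₂, hB₂⟩ := hGnb z hz
  obtain ⟨N₃, Nd₃, C₃, a₃, r₃, hC₃, ha₃, hr₃, hB₃⟩ := hGb z hz
  obtain ⟨N₄, Nd₄, C₄, a₄, r₄, hC₄, ha₄, hr₄, hB₄⟩ := hPb z hz
  -- the total polynomial exponent, the total denominator exponent, and the absorption constant of ★ `one_add_pow_mul_exp_neg_le`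
  set M : ℕ := Nc + N₁ + N₂ + N₃ + N₄ with hM
  set Md : ℕ := Nd₁ + Nd₂ + Nd₃ + Nd₄ with hMd
  set K : ℝ := (2 : ℝ) ^ M * (c₀ ^ (-(a' * M)) + (M.factorial : ℝ) * (2 / b) ^ M) with hK
  have hK0 : 0 ≤ K := by positivity
  refine ⟨Cc * NI * C₁ * C₂ * C₃ * C₄ * K * Ca ^ Md, ac + a₁ + a₂ + a₃ + a₄ + a' * M + κa * Md, b / 2, a', min (min r₁ (min r₂ (min r₃ r₄))) (z.re / 2),
    by positivity, by positivity, half_pos hb, ha', lt_min (lt_min hr₁ (lt_min hr₂ (lt_min hr₃ hr₄))) (by positivity), fun S s hs h hS0 hSd => ?_⟩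
  have hs' : dist s z < min r₁ (min r₂ (min r₃ r₄)) := lt_of_lt_of_le hs (min_le_left _ _)
  have hsz : dist s z < z.re / 2 := lt_of_lt_of_le hs (min_le_right _ _)
  have hs0 : 0 < s.re := re_pos_of_dist_le_half hz hsz.le
  have hs₁ : dist s z < r₁ := lt_of_lt_of_le hs' (min_le_left _ _)
  have hs₂ : dist s z < r₂ := lt_of_lt_of_le hs' ((min_le_right _ _).trans (min_le_left _ _))
  have hs₃ : dist s z < r₃ := lt_of_lt_of_le hs' ((min_le_right _ _).trans ((min_le_right _ _).trans (min_le_left _ _)))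
  have hs₄ : dist s z < r₄ := lt_of_lt_of_le hs' ((min_le_right _ _).trans ((min_le_right _ _).trans (min_le_right _ _)))
  have hHpos : 0 < adelicHeightGL (n + n) L (h : GL (Fin (n + n)) (AdeleRing (𝓞 L) L)) := adelicHeightGL_pos_holds _
  -- CASE SPLIT: a non-vanishing value on `{n∕2 < re}`, or `X(·, S, h) ≡ 0` there
  by_cases hA : ∃ s₀ : ℂ, (n : ℝ) / 2 < s₀.re ∧ (fun s : ℂ => c S h * (∑ i ∈ I S h, Ac S i s h * ∏ v ∈ T S h, Gn S i v s h) * ((∏ v ∈ Pm S h, ((1 - (v.residueCard : ℂ) ^ (-(2 * s))) / ((1 - (v.residueCard : ℂ) ^ (-(2 * s + 1))) * (1 - (quadraticHeckeCharCM L).valueAtUniformizer v * (v.residueCard : ℂ) ^ (-(2 * s + 2)))))) * G s) * ∏ v ∈ D S h, P S h v s) s₀ ≠ 0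
  swap
  · -- `X(·, S, h) ≡ 0` on `{n∕2 < re}`, hence at `s` (identity theorem on the right half-plane): the bound is free
    push Not at hA
    have hzero : (fun s : ℂ => c S h * (∑ i ∈ I S h, Ac S i s h * ∏ v ∈ T S h, Gn S i v s h) * ((∏ v ∈ Pm S h, ((1 - (v.residueCard : ℂ) ^ (-(2 * s))) / ((1 - (v.residueCard : ℂ) ^ (-(2 * s + 1))) * (1 - (quadraticHeckeCharCM L).valueAtUniformizer v * (v.residueCard : ℂ) ^ (-(2 * s + 2)))))) * G s) * ∏ v ∈ D S h, P S h v s) s = (fun _ : ℂ => (0 : ℂ)) s := by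
      have h₁ := (hXhol S h hS0 hSd).mono (Set.sdiff_subset : {s : ℂ | (0 : ℝ) < s.re} \ {(-1 : ℂ)} ⊆ _)
      have h₂ : DifferentiableOn ℂ (fun _ : ℂ => (0 : ℂ)) ({s : ℂ | (0 : ℝ) < s.re} \ {(-1 : ℂ)}) := differentiableOn_const _
      refine eqOn_of_eqOn_halfPlane (s₀ := (-1 : ℂ)) (by positivity : (0 : ℝ) ≤ (n : ℝ) / 2) h₁ h₂ (fun s hs => hA s hs) ⟨hs0, fun h1 => ?_⟩
      rw [Set.mem_singleton_iff] at h1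
      rw [h1] at hs0
      norm_num at hs0
    simp only at hzero
    rw [hzero, norm_zero]
    positivity
  -- a non-vanishing value: the support letter gives a common denominator `d ≤ Ca·H^κa`
  obtain ⟨s₀, hs₀, hX0⟩ := hA
  simp only [ne_eq] at hX0
  obtain ⟨d, hd1, hdle, hint⟩ := hsupp S s₀ h hs₀ hS0 hSd hX0
  -- the five bounds at `(S, s, h)` and the denominator `d`, then the height and the size as opaque reals `H ≥ c₀ > 0`, `τ ≥ 0`
  have hτ0 : 0 ≤ τa S := (norm_nonneg _).trans (hτa S)
  have b0 := hcb S h hS0 hSd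
  have b1 := fun i hi => hB₁ S s hs₁ h hS0 hSd d hd1 hint i hi
  have b2 := fun i hi => hB₂ S s hs₂ h hS0 hSd d hd1 hint i hi
  have b3 := hB₃ S s hs₃ h hS0 hSd d hd1 hint
  have b4 := hB₄ S s hs₄ h hS0 hSd d hd1 hint
  have hfl := hfloor (h : GL (Fin (n + n)) (AdeleRing (𝓞 L) L))
  generalize adelicHeightGL (n + n) L (h : GL (Fin (n + n)) (AdeleRing (𝓞 L) L)) = H at b0 b1 b2 b3 b4 hfl hHpos hdle ⊢
  generalize τa S = τ at b0 b1 b2 b3 b4 hτ0 ⊢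
  have h1τ : 0 ≤ 1 + τ := by linarith
  have hd0 : (0 : ℝ) ≤ (d : ℝ) := Nat.cast_nonneg d
  have hE0 : 0 < Real.exp (-(b * H ^ (-a') * τ)) := Real.exp_pos _
  -- the head: a sum of `#(I S h) ≤ NI` products of an archimedean and a finite factor
  have bS : ‖(∑ i ∈ I S h, Ac S i s h * ∏ v ∈ T S h, Gn S i v s h)‖ ≤
      NI * ((C₁ * H ^ a₁ * (Real.exp (-(b * H ^ (-a') * τ)) * (1 + τ) ^ N₁) * (d : ℝ) ^ Nd₁) * (C₂ * H ^ a₂ * (1 + τ) ^ N₂ * (d : ℝ) ^ Nd₂)) := by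
    have hterm : ∀ i ∈ I S h, ‖Ac S i s h * ∏ v ∈ T S h, Gn S i v s h‖ ≤
        (C₁ * H ^ a₁ * (Real.exp (-(b * H ^ (-a') * τ)) * (1 + τ) ^ N₁) * (d : ℝ) ^ Nd₁) * (C₂ * H ^ a₂ * (1 + τ) ^ N₂ * (d : ℝ) ^ Nd₂) := fun i hi => by
      rw [norm_mul]
      exact mul_le_mul (b1 i hi) (b2 i hi) (norm_nonneg _) (by positivity)
    calc ‖(∑ i ∈ I S h, Ac S i s h * ∏ v ∈ T S h, Gn S i v s h)‖
        ≤ ∑ i ∈ I S h, ‖Ac S i s h * ∏ v ∈ T S h, Gn S i v s h‖ := norm_sum_le _ _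
      _ ≤ ∑ i ∈ I S h, (C₁ * H ^ a₁ * (Real.exp (-(b * H ^ (-a') * τ)) * (1 + τ) ^ N₁) * (d : ℝ) ^ Nd₁) * (C₂ * H ^ a₂ * (1 + τ) ^ N₂ * (d : ℝ) ^ Nd₂) := Finset.sum_le_sum hterm
      _ = ((I S h).card : ℝ) * ((C₁ * H ^ a₁ * (Real.exp (-(b * H ^ (-a') * τ)) * (1 + τ) ^ N₁) * (d : ℝ) ^ Nd₁) * (C₂ * H ^ a₂ * (1 + τ) ^ N₂ * (d : ℝ) ^ Nd₂)) := by
          rw [Finset.sum_const, nsmul_eq_mul]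
      _ ≤ NI * ((C₁ * H ^ a₁ * (Real.exp (-(b * H ^ (-a') * τ)) * (1 + τ) ^ N₁) * (d : ℝ) ^ Nd₁) * (C₂ * H ^ a₂ * (1 + τ) ^ N₂ * (d : ℝ) ^ Nd₂)) :=
          mul_le_mul_of_nonneg_right (Nat.cast_le.2 (hI S h)) (by positivity)
  -- the four factors
  have hX : ‖c S h * (∑ i ∈ I S h, Ac S i s h * ∏ v ∈ T S h, Gn S i v s h) * ((∏ v ∈ Pm S h, ((1 - (v.residueCard : ℂ) ^ (-(2 * s))) / ((1 - (v.residueCard : ℂ) ^ (-(2 * s + 1))) * (1 - (quadraticHeckeCharCM L).valueAtUniformizer v * (v.residueCard : ℂ) ^ (-(2 * s + 2)))))) * G s) * ∏ v ∈ D S h, P S h v s‖ ≤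
      (Cc * H ^ ac * (1 + τ) ^ Nc) * (NI * ((C₁ * H ^ a₁ * (Real.exp (-(b * H ^ (-a') * τ)) * (1 + τ) ^ N₁) * (d : ℝ) ^ Nd₁) * (C₂ * H ^ a₂ * (1 + τ) ^ N₂ * (d : ℝ) ^ Nd₂))) *
        (C₃ * H ^ a₃ * (1 + τ) ^ N₃ * (d : ℝ) ^ Nd₃) * (C₄ * H ^ a₄ * (1 + τ) ^ N₄ * (d : ℝ) ^ Nd₄) := by
    rw [norm_mul, norm_mul, norm_mul]
    exact mul_le_mul (mul_le_mul (mul_le_mul b0 bS (norm_nonneg _) (by positivity)) b3 (norm_nonneg _) (by positivity)) b4 (norm_nonneg _)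
      (by positivity)
  -- collect the powers of `H`, of `1 + τ` and of `d`
  have hregroup : (Cc * H ^ ac * (1 + τ) ^ Nc) * (NI * ((C₁ * H ^ a₁ * (Real.exp (-(b * H ^ (-a') * τ)) * (1 + τ) ^ N₁) * (d : ℝ) ^ Nd₁) * (C₂ * H ^ a₂ * (1 + τ) ^ N₂ * (d : ℝ) ^ Nd₂))) *
        (C₃ * H ^ a₃ * (1 + τ) ^ N₃ * (d : ℝ) ^ Nd₃) * (C₄ * H ^ a₄ * (1 + τ) ^ N₄ * (d : ℝ) ^ Nd₄) =
      (Cc * NI * C₁ * C₂ * C₃ * C₄) * (H ^ ac * H ^ a₁ * H ^ a₂ * H ^ a₃ * H ^ a₄) * (Real.exp (-(b * H ^ (-a') * τ)) * (1 + τ) ^ M) * (d : ℝ) ^ Md := by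
    rw [hM, hMd]
    ring
  have hHpow : H ^ ac * H ^ a₁ * H ^ a₂ * H ^ a₃ * H ^ a₄ = H ^ (ac + a₁ + a₂ + a₃ + a₄) := by
    rw [Real.rpow_add hHpos, Real.rpow_add hHpos, Real.rpow_add hHpos, Real.rpow_add hHpos]
  -- the denominator against the height: `d^{Md} ≤ (Ca·H^κa)^{Md} = Ca^{Md}·H^{κa·Md}`
  have hdpow : (d : ℝ) ^ Md ≤ Ca ^ Md * H ^ (κa * Md) := by
    rw [Real.rpow_mul_natCast hHpos.le, ← mul_pow]
    exact pow_le_pow_left₀ hd0 hdle Md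
  -- absorb `(1 + τ)^M` into the Gaussian (★ `one_add_pow_mul_exp_neg_le`, height floor `c₀ ≤ H`)
  have habs := one_add_pow_mul_exp_neg_le (H := H) (τ := τ) hb hc₀ hfl ha' hτ0 M
  calc ‖c S h * (∑ i ∈ I S h, Ac S i s h * ∏ v ∈ T S h, Gn S i v s h) * ((∏ v ∈ Pm S h, ((1 - (v.residueCard : ℂ) ^ (-(2 * s))) / ((1 - (v.residueCard : ℂ) ^ (-(2 * s + 1))) * (1 - (quadraticHeckeCharCM L).valueAtUniformizer v * (v.residueCard : ℂ) ^ (-(2 * s + 2)))))) * G s) * ∏ v ∈ D S h, P S h v s‖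
      ≤ (Cc * H ^ ac * (1 + τ) ^ Nc) * (NI * ((C₁ * H ^ a₁ * (Real.exp (-(b * H ^ (-a') * τ)) * (1 + τ) ^ N₁) * (d : ℝ) ^ Nd₁) * (C₂ * H ^ a₂ * (1 + τ) ^ N₂ * (d : ℝ) ^ Nd₂))) *
          (C₃ * H ^ a₃ * (1 + τ) ^ N₃ * (d : ℝ) ^ Nd₃) * (C₄ * H ^ a₄ * (1 + τ) ^ N₄ * (d : ℝ) ^ Nd₄) := hX
    _ = (Cc * NI * C₁ * C₂ * C₃ * C₄) * H ^ (ac + a₁ + a₂ + a₃ + a₄) * (Real.exp (-(b * H ^ (-a') * τ)) * (1 + τ) ^ M) * (d : ℝ) ^ Md := by rw [hregroup, hHpow]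
    _ ≤ (Cc * NI * C₁ * C₂ * C₃ * C₄) * H ^ (ac + a₁ + a₂ + a₃ + a₄) * (K * H ^ (a' * M) * Real.exp (-(b / 2 * H ^ (-a') * τ))) * (Ca ^ Md * H ^ (κa * Md)) :=
        mul_le_mul (mul_le_mul_of_nonneg_left habs (by positivity)) hdpow (by positivity) (by positivity)
    _ = (Cc * NI * C₁ * C₂ * C₃ * C₄ * K * Ca ^ Md) * (H ^ (ac + a₁ + a₂ + a₃ + a₄) * H ^ (a' * M) * H ^ (κa * Md)) *
          (Real.exp (-(b / 2 * H ^ (-a') * τ)) * (1 + τ) ^ 0) := by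
        rw [pow_zero, mul_one]
        ring
    _ = (Cc * NI * C₁ * C₂ * C₃ * C₄ * K * Ca ^ Md) * H ^ (ac + a₁ + a₂ + a₃ + a₄ + a' * M + κa * Md) * (Real.exp (-(b / 2 * H ^ (-a') * τ)) * (1 + τ) ^ 0) := by
        rw [← Real.rpow_add hHpos, ← Real.rpow_add hHpos]

end Summit.HodgeConjecture.HodgeConjecture.Cruxes.HLiu418.K2LiuKindOneSingularDecayOfLettersDenTwo

end
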